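import Summits.BirchSwinnertonDyer.BirchSwinnertonDyer.Theorems.KolyvaginDepthDoorDepthTableKuriharaExactRow
import Summits.BirchSwinnertonDyer.BirchSwinnertonDyer.Theorems.KolyvaginDepthDoorDepthTableKuriharaESide3
import Summits.BirchSwinnertonDyer.BirchSwinnertonDyer.Theorems.KolyvaginDepthDoorDepthTableRowsRankDischarged
import Summits.BirchSwinnertonDyer.BirchSwinnertonDyer.Theorems.KolyvaginDepthDoorDepthTableRankTwo681c1Neg8TwistBSDQuotient
import Summits.BirchSwinnertonDyer.BirchSwinnertonDyer.Theorems.KolyvaginDepthDoorDepthTableRow681c1TwoSha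
import Literature.NumberTheory.EllipticCurves.BSDSelmerPConverseSerreProofs
import HarnessLib

/-!
# Route `KolyvaginDepthDoor`, crux `KolyvaginDepthSupplyKN` (stmt-BirchSwinnertonDyer-22820) —
# DEPTH TABLE v18, ROW `681c1` @ `(7, d_K = −8)`: the SOCKET for the fleet's twist record and the EXACT depth-one
# reading in Kurihara currency (twist model `T₀ = [0, -1, 0, -1, -17]` = `681c1^{(−8)}`, conductor `43584`)

Helper file of the lead prover of line `levelone` (kdd-p1 g22; `--supports stmt-BirchSwinnertonDyer-22820
--as helper`); it closes nothing and BSD is NOT proved by it. Same template as `…KuriharaSocket709a1` at `p = 7`.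

The E-side of this row is in the tree (g21: `C681c1.sha_inf_torsionBy_eq_bot_of_kuriharaClaim_7` — `Ш(681c1)[7] = 0` from the
record `cert_681c1` @ `(7, 1163·1667)`, claim `hδE`); every side condition of `E = 681c1` and of the minimal twist model
`T₀` at `p = 7` is a kernel theorem of the lineage or of this file (`goodOrdinary_7`, `hasSurjectiveModNGaloisRep_7` + Serre,
`nonAnomalous_7`, `kodairaNeron_of_five_le 7`, `spadeOne_of_five_le 7`, `heegner_neg8`, `not_hasCM`,
`Rank2Observatory.C681c1.mordellWeilRank_eq_two`; `minTwist8_isElliptic/_isGloballyMinimal/_smul_eq/_card_7`, Kodaira–Néron of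
`T₀` at `7`). What is OWED is one datum on `T₀`:

* `minTwist8_nonAnomalous_7` — `a_7(T₀) = 3 ≢ 1 (mod 7)` (kernel: `#T̃₀(𝔽_7) = 5`). `minTwist8_kodairaNeron_7` — Kodaira–Néron of `T₀` at `7` (`Δ(T₀) = −2^6·3^2·227`).
* `cruxBody_of_twistKuriharaClaim_7_neg8` — **THE SOCKET**: for every `K` with `d_K = −8`, IF some cyclic Kolyvagin level
  `m` of `(T₀, 7)` with `ν(m) ≤ 2` carries a unit mod-`7` Kurihara number (the CLAIM of a future tree record `cert_<T₀>` at
  `(7, m)`, hypothesis `hδT`), THEN the clause of `KolyvaginDepthSupplyKN` holds at `W = 681c1` verbatim (v17's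
  `cruxBody_of_kuriharaClaims_spade` with every other input discharged; Kim Thm. 1.11, modularity, Mazur Cor. 4.1, W. Zhang
  L8.4 (1)/9.1 BY NAME).
* `kolyvaginPrime_iff_twistKuriharaBit_7_neg8` — **THE EXACT DEPTH-ONE READING**: granted the E-side claim `hδE`, «∃ frame,
  Kolyvagin PRIME `ℓ`, datum with `c_1(ℓ) ≠ 0`» ⟺ «for every admissible datum of `T₀`, some cyclic Kolyvagin level of `(T₀, 7)`
  of depth `≤ 1` carries a unit mod-`7` Kurihara number» — g14's generic rank-two row
  `kolyvaginClass_prime_ne_zero_iff_shaTrivial_twistSelmer_of_rank_two_of_lemma84` («bit ⟺ Ш(E)[7] = 0 ∧ #Sel_7(E^{(−8)}) ≤ 7»,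
  (γ) + W. Zhang by name; rank `= 2` by kernel 2-descent) ∘ v18's twist IFF (Sakamoto Thm. 1.2/1.5 + Kim Thm. 1.11 by name).
  The fleet's datum for this row is EXACTLY one residue `δ̃_ℓ(T₀) mod 7` at a cyclic Kolyvagin prime `ℓ` of `(T₀, 7)`
  (`ℓ ∤ 7·43584`, `ℓ ≡ 1 (mod 7)`, `a_ℓ(T₀) ≡ 2 (mod 7)`, `49 ∤ #T̃₀(𝔽_ℓ)`).

CONDITIONAL on the named facts displayed (`hKim`, `hSak1`, `hSak2`, `hnf`, `hMaz`, `h372`, `h84`) and on the record claims;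
per curve; nothing class-wide; BSD is NOT proved by any of this.

References: [Sakamoto2022pSelmer] Thm. 1.2, Thm. 1.5; [Kim2022StructureSelmer] Thm. 1.11, §1.2.2; [WZhang2014] Lemma 8.4 (1),
Thm. 9.1; [GrossLMS1991] Prop. 3.7 (2); [Mazur1978] Cor. 4.1; [CremonaAlgorithms1997] Table 1 (681c1); [SilvermanAEC2009]
VII.3.1, VIII.8, X.4.2, X.5 Cor. 5.4.
-/

set_option linter.dupNamespace false

noncomputable section

open scoped Classical NumberField

namespace Summit.BirchSwinnertonDyer.BirchSwinnertonDyer.Theorems.KolyvaginDepthDoor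

open Literature.NumberTheory.EllipticCurves Literature.NumberTheory.EllipticCurves.ModularForms
  WeierstrassCurve NumberField IsDedekindDomain
open Summit.BirchSwinnertonDyer.BirchSwinnertonDyer.Theorems
open Summit.BirchSwinnertonDyer.BirchSwinnertonDyer.Rank2Observatory
open Summit.BirchSwinnertonDyer.BirchSwinnertonDyer.Rank1Residual (IntModel.frobeniusTrace_eq)
open Summit.BirchSwinnertonDyer.Rank1Residual.Additive

namespace C681c1

/-- **`7` is non-anomalous for the twist model `T₀ = [0, -1, 0, -1, -17]`**: `#T̃₀(𝔽_7) = 5`, `a_7(T₀) = 3`,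
`7 ∤ a_7(T₀) − 1` (Sakamoto's hypothesis (c) / Kim's (iii) for `T₀`). [cite: SilvermanAEC2009, VII.3 Prop. 3.1] -/
theorem minTwist8_nonAnomalous_7 :
    haveI := minTwist8_isGloballyMinimal; haveI := Fact.mk (by norm_num : Nat.Prime 7);
    ¬ ((7 : ℕ) : ℤ) ∣ ((⟨0, -1, 0, -1, -17⟩ : WeierstrassCurve ℤ).map (Int.castRingHom ℚ)).frobeniusTrace 7 - 1 := by
  haveI := minTwist8_isElliptic
  haveI := minTwist8_isGloballyMinimal
  haveI := Fact.mk (by norm_num : Nat.Prime 7)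
  rw [IntModel.frobeniusTrace_eq minTwist8_intModel minTwist8_card_7]
  decide

/-- **Kodaira–Néron for `T₀ = [0, -1, 0, -1, -17]` at `7`**: `Δ(T₀) = −130752 = −2^6 · 3^2 · 227`, every exponent `< 7`
(table lemma `not_dvd_ordMinimalDiscriminant_of_intModel_table`, as the lineage's `minTwist8_kodairaNeron_5`). Hence `7 ∤ Tam(T₀)`.
[cite: SilvermanAEC2009, VII.5.1, VIII.8, C.15 Table 15.1] -/
theorem minTwist8_kodairaNeron_7 :
    haveI := minTwist8_isElliptic; haveI := minTwist8_isGloballyMinimal;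
    ∀ v : HeightOneSpectrum (𝓞 ℚ),
      ((⟨0, -1, 0, -1, -17⟩ : WeierstrassCurve ℤ).map (Int.castRingHom ℚ)).HasMultiplicativeReductionAt v →
      ¬ 7 ∣ ((⟨0, -1, 0, -1, -17⟩ : WeierstrassCurve ℤ).map (Int.castRingHom ℚ)).ordMinimalDiscriminant v := by
  haveI := minTwist8_isElliptic
  haveI := minTwist8_isGloballyMinimal
  exact not_dvd_ordMinimalDiscriminant_of_intModel_table minTwist8_intModel (p := 7) (Δ₀ := (-130752))
    (by decide +kernel) (B := 11) (by decide +kernel)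
    (by
      intro q hq hqP hqd
      have hn : ((-130752 : ℤ).natAbs) = 2 ^ 6 * (3 ^ 2 * (227 ^ 1)) := by norm_num
      rw [hn] at hqd ⊢
      rcases (Nat.Prime.dvd_mul hqP).mp hqd with h | h0
      · obtain rfl := (Nat.prime_dvd_prime_iff_eq hqP (by norm_num)).mp (hqP.dvd_of_dvd_pow h)
        exact ⟨6, by simp, by decide +kernel, by decide +kernel, by norm_num⟩
      · rcases (Nat.Prime.dvd_mul hqP).mp h0 with h | h1
        · obtain rfl := (Nat.prime_dvd_prime_iff_eq hqP (by norm_num)).mp (hqP.dvd_of_dvd_pow h)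
          exact ⟨2, by simp, by decide +kernel, by decide +kernel, by norm_num⟩
        · obtain rfl := (Nat.prime_dvd_prime_iff_eq hqP (by norm_num)).mp (hqP.dvd_of_dvd_pow h1)
          exact absurd (Finset.mem_range.mp hq) (by norm_num)
      )

/-- **THE SOCKET for row `681c1` @ `(7, −8)`: the clause of `KolyvaginDepthSupplyKN` at `W = 681c1` from the EXISTING
E-side record claim and ONE FUTURE twist record claim.** For every imaginary quadratic `K` with `d_K = −8`: granted
Kim Thm. 1.11 (`hKim`), modularity (`hnf`), Mazur Cor. 4.1 (`hMaz`), W. Zhang L8.4 (1)/9.1 (`h84`) BY NAME, the claim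
`hδE` of the tree record `cert_681c1` @ `(7, 1938721 = 1163·1667)`, and — THE DATUM OWED — a cyclic Kolyvagin level `m` of
`(T₀, 7)` (`hm`) of depth `ν(m) ≤ 2` (`hμ`) whose claim `hδT` holds, the crux's clause holds at `681c1` VERBATIM. CONDITIONAL
on the four named facts and the two claims; per curve; BSD is not proved by it.
[cite: Kim2022StructureSelmer, Thm. 1.11 (PDF p. 8)] [cite: WZhang2014, Lemma 8.4 (1) (p. 236), Thm. 9.1 (p. 240)]
[cite: Mazur1978, Cor. 4.1] [cite: CremonaAlgorithms1997, Table 1 (681c1)] -/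
theorem cruxBody_of_twistKuriharaClaim_7_neg8
    (hKim : Kim2022_card_selmerGroup_le_pow_of_kuriharaNumber_ne_zero)
    (hnf : exists_isNewformOf) (hMaz : mazur_not_dvd_maninConstant_of_odd)
    (h84 : Literature.NumberTheory.EllipticCurves.WZhang2014_lemma84_exists_minimal_kolyvaginClass_one_selmerCard)
    (K : Type) [Field K] [NumberField K] (hK : IsImaginaryQuadratic K) (hD : NumberField.discr K = -8)
    (hδE : haveI := isElliptic_c681c1; haveI := isGloballyMinimal_c681c1;
      haveI : NeZero (((⟨0, -1, 1, 0, 2⟩ : WeierstrassCurve ℤ).map (Int.castRingHom ℚ)).conductorNorm ℤ) := neZero_conductorNorm_of_isElliptic _;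
      haveI := Fact.mk (by norm_num : Nat.Prime 7);
      ∀ (D : ModularParametrizationData ((⟨0, -1, 1, 0, 2⟩ : WeierstrassCurve ℤ).map (Int.castRingHom ℚ)) (((⟨0, -1, 1, 0, 2⟩ : WeierstrassCurve ℤ).map (Int.castRingHom ℚ)).conductorNorm ℤ)), ¬ ((7 : ℕ) : ℤ) ∣ D.maninConstant →
        (∃ u : ℚ, ‖(u : ℚ_[7])‖ = 1 ∧ ((⟨0, -1, 1, 0, 2⟩ : WeierstrassCurve ℤ).map (Int.castRingHom ℚ)).realPeriodRat = u * plusPeriod D.f) →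
        ∃ ψ : (ℓ : ℕ) → (ZMod ℓ)ˣ →* Multiplicative (ZMod 7),
          (∀ ℓ ∈ (1938721 : ℕ).primeFactors, Function.Surjective (ψ ℓ)) ∧ kuriharaNumber D.f 7 1938721 ψ ≠ 0)
    (m : ℕ) [NeZero m]
    (hm : haveI := minTwist8_isGloballyMinimal;
      IsCyclicKolyvaginLevel ((⟨0, -1, 0, -1, -17⟩ : WeierstrassCurve ℤ).map (Int.castRingHom ℚ)) 7 m)
    (hμ : m.primeFactors.card ≤ 2)
    (hδT : haveI := minTwist8_isElliptic; haveI := minTwist8_isGloballyMinimal;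
      haveI : NeZero (((⟨0, -1, 0, -1, -17⟩ : WeierstrassCurve ℤ).map (Int.castRingHom ℚ)).conductorNorm ℤ) :=
        neZero_conductorNorm_of_isElliptic _;
      haveI := Fact.mk (by norm_num : Nat.Prime 7);
      ∀ (D : ModularParametrizationData ((⟨0, -1, 0, -1, -17⟩ : WeierstrassCurve ℤ).map (Int.castRingHom ℚ))
          (((⟨0, -1, 0, -1, -17⟩ : WeierstrassCurve ℤ).map (Int.castRingHom ℚ)).conductorNorm ℤ)),
        ¬ ((7 : ℕ) : ℤ) ∣ D.maninConstant →
        (∃ u : ℚ, ‖(u : ℚ_[7])‖ = 1 ∧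
          ((⟨0, -1, 0, -1, -17⟩ : WeierstrassCurve ℤ).map (Int.castRingHom ℚ)).realPeriodRat = u * plusPeriod D.f) →
        ∃ ψ : (ℓ : ℕ) → (ZMod ℓ)ˣ →* Multiplicative (ZMod 7),
          (∀ ℓ ∈ m.primeFactors, Function.Surjective (ψ ℓ)) ∧ kuriharaNumber D.f 7 m ψ ≠ 0) :
    haveI := isElliptic_c681c1; haveI := isGloballyMinimal_c681c1;
    ∃ (p : ℕ) (hp : Fact p.Prime), 5 ≤ p ∧ ((⟨0, -1, 1, 0, 2⟩ : WeierstrassCurve ℤ).map (Int.castRingHom ℚ)).HasGoodReductionAtPrime p ∧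
      ¬ (p : ℤ) ∣ ((⟨0, -1, 1, 0, 2⟩ : WeierstrassCurve ℤ).map (Int.castRingHom ℚ)).frobeniusTrace p ∧
      (∀ n : ℕ, ((⟨0, -1, 1, 0, 2⟩ : WeierstrassCurve ℤ).map (Int.castRingHom ℚ)).HasSurjectiveModNGaloisRep (p ^ n : ℕ)) ∧
      (∀ v : HeightOneSpectrum (𝓞 ℚ), ((⟨0, -1, 1, 0, 2⟩ : WeierstrassCurve ℤ).map (Int.castRingHom ℚ)).HasMultiplicativeReductionAt v →
        ¬ p ∣ ((⟨0, -1, 1, 0, 2⟩ : WeierstrassCurve ℤ).map (Int.castRingHom ℚ)).ordMinimalDiscriminant v) ∧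
      ∃ (K : Type) (_ : Field K) (_ : NumberField K), IsImaginaryQuadratic K ∧
        NumberField.discr K ≠ -3 ∧ NumberField.discr K ≠ -4 ∧
        ∃ (_ : NeZero (((⟨0, -1, 1, 0, 2⟩ : WeierstrassCurve ℤ).map (Int.castRingHom ℚ)).conductorNorm ℤ)),
          SatisfiesHeegnerHypothesis (((⟨0, -1, 1, 0, 2⟩ : WeierstrassCurve ℤ).map (Int.castRingHom ℚ)).conductorNorm ℤ) K ∧
        ∃ (Dt : ModularParametrizationData ((⟨0, -1, 1, 0, 2⟩ : WeierstrassCurve ℤ).map (Int.castRingHom ℚ)) (((⟨0, -1, 1, 0, 2⟩ : WeierstrassCurve ℤ).map (Int.castRingHom ℚ)).conductorNorm ℤ))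
          (β : ℤ) (ι : K →+* ℂ) (n₁ : ℕ) (d : KolyvaginHeegnerData Dt β ι n₁), Squarefree n₁ ∧
          (∀ q ∈ n₁.primeFactors, Zhang2014.IsKolyvaginPrime (((⟨0, -1, 1, 0, 2⟩ : WeierstrassCurve ℤ).map (Int.castRingHom ℚ)).conductorNorm ℤ)
            ((⟨0, -1, 1, 0, 2⟩ : WeierstrassCurve ℤ).map (Int.castRingHom ℚ)) K p q) ∧
          d.kolyvaginClass hp.out 1 ≠ 0 ∧
          (n₁.primeFactors.card + 1 ≤ ((⟨0, -1, 1, 0, 2⟩ : WeierstrassCurve ℤ).map (Int.castRingHom ℚ)).mordellWeilRank ∨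
            (n₁.primeFactors.card ≤ ((⟨0, -1, 1, 0, 2⟩ : WeierstrassCurve ℤ).map (Int.castRingHom ℚ)).mordellWeilRank ∧
              n₁.primeFactors.card + 1 ≤ (((⟨0, -1, 1, 0, 2⟩ : WeierstrassCurve ℤ).map (Int.castRingHom ℚ)).quadraticTwist
                (NumberField.discr K : ℚ)).mordellWeilRank)) := by
  haveI := isElliptic_c681c1
  haveI := isGloballyMinimal_c681c1
  haveI iNZ : NeZero (((⟨0, -1, 1, 0, 2⟩ : WeierstrassCurve ℤ).map (Int.castRingHom ℚ)).conductorNorm ℤ) :=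
    neZero_conductorNorm_of_isElliptic _
  haveI := minTwist8_isElliptic
  haveI := minTwist8_isGloballyMinimal
  haveI iNZT : NeZero (((⟨0, -1, 0, -1, -17⟩ : WeierstrassCurve ℤ).map (Int.castRingHom ℚ)).conductorNorm ℤ) :=
    neZero_conductorNorm_of_isElliptic _
  haveI iP := Fact.mk (by norm_num : Nat.Prime 7)
  haveI : NeZero (1938721 : ℕ) := ⟨by norm_num⟩
  have hsp := spadeOne_of_five_le 7 (by norm_num)
  have hS2 : ¬ Squarefree (((⟨0, -1, 1, 0, 2⟩ : WeierstrassCurve ℤ).map (Int.castRingHom ℚ)).conductorNorm ℤ) →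
      (∃ (ℓ : ℕ) (_ : Fact ℓ.Prime), ((⟨0, -1, 1, 0, 2⟩ : WeierstrassCurve ℤ).map (Int.castRingHom ℚ)).HasMultiplicativeReductionAtPrime ℓ ∧
          ¬ 7 ∣ padicValInt ℓ ((⟨0, -1, 1, 0, 2⟩ : WeierstrassCurve ℤ).map (Int.castRingHom ℚ)).minimalDiscriminantInt) ∧
        ∃ (ℓ₁ ℓ₂ : ℕ) (_ : Fact ℓ₁.Prime) (_ : Fact ℓ₂.Prime), ℓ₁ ≠ ℓ₂ ∧
          ((⟨0, -1, 1, 0, 2⟩ : WeierstrassCurve ℤ).map (Int.castRingHom ℚ)).HasMultiplicativeReductionAtPrime ℓ₁ ∧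
          ((⟨0, -1, 1, 0, 2⟩ : WeierstrassCurve ℤ).map (Int.castRingHom ℚ)).HasMultiplicativeReductionAtPrime ℓ₂ :=
    fun hns ↦ absurd ((((⟨0, -1, 1, 0, 2⟩ : WeierstrassCurve ℤ).map (Int.castRingHom ℚ))).isSemistable_iff_squarefree_conductorNorm.mp hsp.2) hns
  have hH := satisfiesHeegnerHypothesis_conductorNorm_of_intModel intModel K hK.1 hD heegner_neg8
  have hD3 : NumberField.discr K ≠ -3 := by rw [hD]; norm_num
  have hD4 : NumberField.discr K ≠ -4 := by rw [hD]; norm_num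
  have hpD : ¬ (((7 : ℕ) : ℤ) ∣ NumberField.discr K) := by rw [hD]; decide
  have hsur : ((⟨0, -1, 1, 0, 2⟩ : WeierstrassCurve ℤ).map (Int.castRingHom ℚ)).HasSurjectiveModNGaloisRep ((7 : ℕ) : ℤ) := by
    simpa using hasSurjectiveModNGaloisRep_7
  have htower : ∀ k : ℕ, ((⟨0, -1, 1, 0, 2⟩ : WeierstrassCurve ℤ).map (Int.castRingHom ℚ)).HasSurjectiveModNGaloisRep ((7 : ℕ) ^ k : ℕ) :=
    serre_hasSurjectiveModNGaloisRep_pow_holds _ 7 (by norm_num) hsur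
  have hC : (⟨Units.mk0 ((1 : ℚ) / 2) (by norm_num), (1 : ℚ), (0 : ℚ), (0 : ℚ)⟩ : WeierstrassCurve.VariableChange ℚ) •
      ((⟨0, -1, 0, -1, -17⟩ : WeierstrassCurve ℤ).map (Int.castRingHom ℚ)) =
      ((⟨0, -1, 1, 0, 2⟩ : WeierstrassCurve ℤ).map (Int.castRingHom ℚ)).quadraticTwist (NumberField.discr K : ℚ) := by
    rw [hD]; push_cast; exact minTwist8_smul_eq
  have hrank : 2 ≤ ((⟨0, -1, 1, 0, 2⟩ : WeierstrassCurve ℤ).map (Int.castRingHom ℚ)).mordellWeilRank :=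
    KernelCerts002.C681c1.two_le_rank
  have hr2 := Summit.BirchSwinnertonDyer.BirchSwinnertonDyer.Rank2Observatory.C681c1.mordellWeilRank_eq_two
  have hν' : (1938721 : ℕ).primeFactors.card ≤ ((⟨0, -1, 1, 0, 2⟩ : WeierstrassCurve ℤ).map (Int.castRingHom ℚ)).mordellWeilRank := by
    rw [hr2, show (1938721 : ℕ) = 1163 * 1667 from rfl, Nat.primeFactors_mul (by norm_num) (by norm_num),
      Nat.Prime.primeFactors (by norm_num), Nat.Prime.primeFactors (by norm_num)]
    decide
  have hμ' : m.primeFactors.card ≤ ((⟨0, -1, 1, 0, 2⟩ : WeierstrassCurve ℤ).map (Int.castRingHom ℚ)).mordellWeilRank := by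
    rw [hr2]; exact hμ
  exact cruxBody_of_kuriharaClaims_spade hKim hnf hMaz h84 _ hrank 7 (by norm_num) goodOrdinary_7.1 goodOrdinary_7.2 htower
    (kodairaNeron_of_five_le 7 (by norm_num)) nonAnomalous_7 hsp.1 hS2 K hK hD3 hD4 hpD hH 1938721 isCyclicKolyvaginLevel_7_1938721 hν' hδE
    ((⟨0, -1, 0, -1, -17⟩ : WeierstrassCurve ℤ).map (Int.castRingHom ℚ)) _ hC minTwist8_nonAnomalous_7
    minTwist8_kodairaNeron_7 m hm hμ' hδT

/-- **THE EXACT DEPTH-ONE READING of row `681c1` @ `(7, −8)` in Kurihara currency.** Granted the E-side claim `hδE`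
(record `cert_681c1` @ `(7, 1163·1667)`; with Kim Thm. 1.11 it gives `Ш(681c1)[7] = 0`) and the named facts displayed:
for every `K` with `d_K = −8`, «some frame, some Kolyvagin PRIME `ℓ`, some Kolyvagin–Heegner datum of conductor `ℓ` with
`c_1(ℓ) ≠ 0`» holds IF AND ONLY IF «for every datum `D` of `T₀ = [0, -1, 0, -1, -17]` at level `N_{T₀}` with `7 ∤ c_D` and the
period transfer, some cyclic Kolyvagin level `m` of `(T₀, 7)` with `ν(m) ≤ 1` carries a unit mod-`7` Kurihara number» —
g14's generic rank-two row (`kolyvaginClass_prime_ne_zero_iff_shaTrivial_twistSelmer_of_rank_two_of_lemma84`, (γ) + W. Zhang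
by name, rank `= 2` by kernel 2-descent) ∘ v18's twist IFF (Sakamoto Thm. 1.2/1.5 + Kim Thm. 1.11 + modularity + Mazur by
name). So the row's missing datum is EXACTLY one residue `δ̃_ℓ(T₀) mod 7` at a cyclic Kolyvagin prime `ℓ` of `(T₀, 7)`
(conductor `N_{T₀} = 43584`, inside the kurihara fleet's range). CONDITIONAL on the seven named facts and the claim `hδE`;
per curve; BSD is not proved by it. [cite: Sakamoto2022pSelmer, Thm. 1.2, Thm. 1.5] [cite: Kim2022StructureSelmer, Thm. 1.11]
[cite: WZhang2014, Lemma 8.4 (1) (p. 236)] [cite: GrossLMS1991, Prop. 3.7 (2), §5 (5.1)] [cite: CremonaAlgorithms1997, Table 1 (681c1)] -/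
theorem kolyvaginPrime_iff_twistKuriharaBit_7_neg8
    (h372 : GrossLMS1991.prop37_2_frobeniusCongruence)
    (h84 : Literature.NumberTheory.EllipticCurves.WZhang2014_lemma84_exists_minimal_kolyvaginClass_one_selmerCard)
    (hKim : Kim2022_card_selmerGroup_le_pow_of_kuriharaNumber_ne_zero)
    (hSak1 : Sakamoto2022_card_selmerGroup_eq_pow_of_isDeltaMinimal)
    (hSak2 : Sakamoto2022_exists_cyclicLevel_kuriharaNumber_ne_zero)
    (hnf : exists_isNewformOf) (hMaz : mazur_not_dvd_maninConstant_of_odd)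
    (K : Type) [Field K] [NumberField K] (hK : IsImaginaryQuadratic K) (hD : NumberField.discr K = -8)
    (hδE : haveI := isElliptic_c681c1; haveI := isGloballyMinimal_c681c1;
      haveI : NeZero (((⟨0, -1, 1, 0, 2⟩ : WeierstrassCurve ℤ).map (Int.castRingHom ℚ)).conductorNorm ℤ) := neZero_conductorNorm_of_isElliptic _;
      haveI := Fact.mk (by norm_num : Nat.Prime 7);
      ∀ (D : ModularParametrizationData ((⟨0, -1, 1, 0, 2⟩ : WeierstrassCurve ℤ).map (Int.castRingHom ℚ)) (((⟨0, -1, 1, 0, 2⟩ : WeierstrassCurve ℤ).map (Int.castRingHom ℚ)).conductorNorm ℤ)), ¬ ((7 : ℕ) : ℤ) ∣ D.maninConstant →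
        (∃ u : ℚ, ‖(u : ℚ_[7])‖ = 1 ∧ ((⟨0, -1, 1, 0, 2⟩ : WeierstrassCurve ℤ).map (Int.castRingHom ℚ)).realPeriodRat = u * plusPeriod D.f) →
        ∃ ψ : (ℓ : ℕ) → (ZMod ℓ)ˣ →* Multiplicative (ZMod 7),
          (∀ ℓ ∈ (1938721 : ℕ).primeFactors, Function.Surjective (ψ ℓ)) ∧ kuriharaNumber D.f 7 1938721 ψ ≠ 0) :
    haveI := isElliptic_c681c1; haveI := isGloballyMinimal_c681c1;
    haveI : NeZero (((⟨0, -1, 1, 0, 2⟩ : WeierstrassCurve ℤ).map (Int.castRingHom ℚ)).conductorNorm ℤ) := neZero_conductorNorm_of_isElliptic _;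
    haveI := minTwist8_isElliptic; haveI := minTwist8_isGloballyMinimal;
    haveI : NeZero (((⟨0, -1, 0, -1, -17⟩ : WeierstrassCurve ℤ).map (Int.castRingHom ℚ)).conductorNorm ℤ) := neZero_conductorNorm_of_isElliptic _;
    haveI := Fact.mk (by norm_num : Nat.Prime 7);
    (∃ (Dt : ModularParametrizationData ((⟨0, -1, 1, 0, 2⟩ : WeierstrassCurve ℤ).map (Int.castRingHom ℚ)) (((⟨0, -1, 1, 0, 2⟩ : WeierstrassCurve ℤ).map (Int.castRingHom ℚ)).conductorNorm ℤ)) (β : ℤ)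
      (ι : K →+* ℂ) (ℓ : ℕ) (d : KolyvaginHeegnerData Dt β ι ℓ),
      ℓ.Prime ∧ Zhang2014.IsKolyvaginPrime (((⟨0, -1, 1, 0, 2⟩ : WeierstrassCurve ℤ).map (Int.castRingHom ℚ)).conductorNorm ℤ) ((⟨0, -1, 1, 0, 2⟩ : WeierstrassCurve ℤ).map (Int.castRingHom ℚ)) K 7 ℓ ∧
        d.kolyvaginClass (p := 7) (by norm_num) 1 ≠ 0) ↔
    (∀ (D : ModularParametrizationData ((⟨0, -1, 0, -1, -17⟩ : WeierstrassCurve ℤ).map (Int.castRingHom ℚ))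
          (((⟨0, -1, 0, -1, -17⟩ : WeierstrassCurve ℤ).map (Int.castRingHom ℚ)).conductorNorm ℤ)),
        ¬ ((7 : ℕ) : ℤ) ∣ D.maninConstant →
        (∃ u : ℚ, ‖(u : ℚ_[7])‖ = 1 ∧
          ((⟨0, -1, 0, -1, -17⟩ : WeierstrassCurve ℤ).map (Int.castRingHom ℚ)).realPeriodRat = u * plusPeriod D.f) →
        ∃ (m : ℕ) (_ : NeZero m), IsCyclicKolyvaginLevel ((⟨0, -1, 0, -1, -17⟩ : WeierstrassCurve ℤ).map (Int.castRingHom ℚ)) 7 m ∧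
          m.primeFactors.card ≤ 1 ∧
          ∃ ψ : (ℓ : ℕ) → (ZMod ℓ)ˣ →* Multiplicative (ZMod 7),
            (∀ ℓ ∈ m.primeFactors, Function.Surjective (ψ ℓ)) ∧ kuriharaNumber D.f 7 m ψ ≠ 0) := by
  haveI := isElliptic_c681c1
  haveI := isGloballyMinimal_c681c1
  haveI iNZ : NeZero (((⟨0, -1, 1, 0, 2⟩ : WeierstrassCurve ℤ).map (Int.castRingHom ℚ)).conductorNorm ℤ) :=
    neZero_conductorNorm_of_isElliptic _
  haveI := minTwist8_isElliptic
  haveI := minTwist8_isGloballyMinimal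
  haveI iNZT : NeZero (((⟨0, -1, 0, -1, -17⟩ : WeierstrassCurve ℤ).map (Int.castRingHom ℚ)).conductorNorm ℤ) :=
    neZero_conductorNorm_of_isElliptic _
  haveI iP := Fact.mk (by norm_num : Nat.Prime 7)
  have hsha := sha_inf_torsionBy_eq_bot_of_kuriharaClaim_7 hKim hnf hMaz hδE
  have hsur : ((⟨0, -1, 1, 0, 2⟩ : WeierstrassCurve ℤ).map (Int.castRingHom ℚ)).HasSurjectiveModNGaloisRep ((7 : ℕ) : ℤ) := by
    simpa using hasSurjectiveModNGaloisRep_7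
  have htower : ∀ k : ℕ, ((⟨0, -1, 1, 0, 2⟩ : WeierstrassCurve ℤ).map (Int.castRingHom ℚ)).HasSurjectiveModNGaloisRep ((7 : ℕ) ^ k : ℕ) :=
    serre_hasSurjectiveModNGaloisRep_pow_holds _ 7 (by norm_num) hsur
  have hsp := spadeOne_of_five_le 7 (by norm_num)
  have hS2 : ¬ Squarefree (((⟨0, -1, 1, 0, 2⟩ : WeierstrassCurve ℤ).map (Int.castRingHom ℚ)).conductorNorm ℤ) →
      (∃ (ℓ : ℕ) (_ : Fact ℓ.Prime), ((⟨0, -1, 1, 0, 2⟩ : WeierstrassCurve ℤ).map (Int.castRingHom ℚ)).HasMultiplicativeReductionAtPrime ℓ ∧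
          ¬ 7 ∣ padicValInt ℓ ((⟨0, -1, 1, 0, 2⟩ : WeierstrassCurve ℤ).map (Int.castRingHom ℚ)).minimalDiscriminantInt) ∧
        ∃ (ℓ₁ ℓ₂ : ℕ) (_ : Fact ℓ₁.Prime) (_ : Fact ℓ₂.Prime), ℓ₁ ≠ ℓ₂ ∧
          ((⟨0, -1, 1, 0, 2⟩ : WeierstrassCurve ℤ).map (Int.castRingHom ℚ)).HasMultiplicativeReductionAtPrime ℓ₁ ∧
          ((⟨0, -1, 1, 0, 2⟩ : WeierstrassCurve ℤ).map (Int.castRingHom ℚ)).HasMultiplicativeReductionAtPrime ℓ₂ :=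
    fun hns ↦ absurd ((((⟨0, -1, 1, 0, 2⟩ : WeierstrassCurve ℤ).map (Int.castRingHom ℚ))).isSemistable_iff_squarefree_conductorNorm.mp hsp.2) hns
  have hH := satisfiesHeegnerHypothesis_conductorNorm_of_intModel intModel K hK.1 hD heegner_neg8
  have hD3 : NumberField.discr K ≠ -3 := by rw [hD]; norm_num
  have hD4 : NumberField.discr K ≠ -4 := by rw [hD]; norm_num
  have hpD : ¬ (((7 : ℕ) : ℤ) ∣ NumberField.discr K) := by rw [hD]; decide
  have hC : (⟨Units.mk0 ((1 : ℚ) / 2) (by norm_num), (1 : ℚ), (0 : ℚ), (0 : ℚ)⟩ : WeierstrassCurve.VariableChange ℚ) •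
      ((⟨0, -1, 0, -1, -17⟩ : WeierstrassCurve ℤ).map (Int.castRingHom ℚ)) =
      ((⟨0, -1, 1, 0, 2⟩ : WeierstrassCurve ℤ).map (Int.castRingHom ℚ)).quadraticTwist ((NumberField.discr K : ℤ) : ℚ) := by
    rw [hD]; push_cast; exact minTwist8_smul_eq
  have hr2 := Summit.BirchSwinnertonDyer.BirchSwinnertonDyer.Rank2Observatory.C681c1.mordellWeilRank_eq_two
  have hT := natCard_selmerGroup_quadraticTwist_le_iff_kuriharaBit hKim hSak1 hSak2 hnf hMaz _ 7 (by norm_num) goodOrdinary_7.1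
    goodOrdinary_7.2 hsur (NumberField.discr_ne_zero K) hpD _ _ hC minTwist8_nonAnomalous_7 minTwist8_kodairaNeron_7 1
  rw [pow_one] at hT
  rw [kolyvaginClass_prime_ne_zero_iff_shaTrivial_twistSelmer_of_rank_two_of_lemma84 h372 h84 _ not_hasCM 7 (by norm_num)
    goodOrdinary_7.1 goodOrdinary_7.2 htower (kodairaNeron_of_five_le 7 (by norm_num)) hsp.1 hS2 K hK hD3 hD4 hpD hH hr2,
    and_iff_right hsha]
  exact hT

end C681c1

end Summit.BirchSwinnertonDyer.BirchSwinnertonDyer.Theorems.KolyvaginDepthDoor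

end
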